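import Summits.BirchSwinnertonDyer.BirchSwinnertonDyer.Theorems.TeichmullerTwistDescentWeightExclusionOfSignedWeight
import Literature.NumberTheory.EllipticCurves.FullLevelHomologySerreWeightOfEigenMap
import HarnessLib

/-!
# Route `TeichmullerTwistDescent`, crux K `TwistedPeriodLatticeSaturation` (stmt-BirchSwinnertonDyer-25368):
# K and (W‴) from NAMED inputs only — the signed weight statement is now the Literature fact
# `fullLevelHomology_twist_isModular_of_eigenMap_signed`

Cell `pub/bsd-wall` (D-0145 line route-BirchSwinnertonDyer-TeichmullerTwistDescent, OPEN rev 7), seat `bsd-line-ttd-p1` (prover 1/2,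
g28).  THEOREMS ONLY; `--supports stmt-BirchSwinnertonDyer-25368`.  BSD is not proved by this file; K is NOT proved by this file (it is
proved CONDITIONALLY on five named hypotheses, every one a cite-only published statement or modularity); nothing here closes an item.

WHAT.  `TeichmullerTwistDescentWeightExclusionOfSignedWeight` (g27) proved (W‴) `NoEtaleWeightEigenQuotient` in full and K from five inputs,
the third of which — the SIGNED weight statement, `p − 1 ∣ s + c` — was spelled inline as the hypothesis `hWt1` because the residue of `s`
depends on the dictionary between the tree's chain-level Hecke operator `heckeT` on the full-level carrier and classical Hecke eigenvalues.
That dictionary has now been COMPUTED for the tree's fixed definitions (seat memo `KLINE-SIGN-ttdp1g28.md`, evidence on 25368): for a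
`GL₂(𝔽_p)`-equivariant eigen-map `Θ : H₁(Γ₀(M), ℤ_p[GL₂(𝔽_p)]) → Sym^g_row ⊗ det^c` the system is `λ_q = q^{−g−c}·a_q(f)`
(`f` of weight `g + 2` on `Γ₀(M)`), `= q^{c}·a_q(f)` under `p − 1 ∣ g + 2c`, i.e. `ρ̄_f ≅ ω^{g+c} ρ̄_E`, **`s ≡ −c (mod p − 1)`** —
edge map `Hom_{k[G]}(H₁(Γ₀(M), k[G]), V) ≅ H¹(Γ₀(M), V)` off Eisenstein systems, duality `H¹(V) = H₁(V^*)^*`,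
`V^* ≅ Sym^g ⊗ det^{−g−c}`, and the Eichler–Shimura / modular-symbol dictionary for the main-involution action (Shimura (8.3.2), Merel 1994
Prop. 10), checked by two numeric certificates run from the chain-level formulas (`p = 11`, `Sym^{10} ⊗ det^c`, all `c`, `q ∈ {2,3,5,7}`:
40/40; `H₁(SL₂ℤ, Sym^g ⊗ det^c)`, `g ∈ {10,14,16,20}`: 24/24).  Accordingly the signed statement is the Literature named fact
`Literature.NumberTheory.EllipticCurves.fullLevelHomology_twist_isModular_of_eigenMap_signed` (text = `hWt1` verbatim), and this file
rewrites the K-line's conclusions with NAMED hypotheses only: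

* `fullLevelHomology_twist_isModular_of_eigenMap_of_signed` — signed ⟹ sign-free (the two named facts are consistent);
* `noEtaleWeightEigenQuotient_of_named_facts` — **(W‴)** `NoEtaleWeightEigenQuotient` IN FULL (Kodaira II, III, IV) ⟸ SIGNED WEIGHT ∧
  Kraus 1997 Prop. 1 ∧ Edixhoven 1992 Thm. 4.5;
* `twistedPeriodLatticeSaturation_of_named_inputs` — **K** (`TwistedPeriodLatticeSaturation`, the route decl VERBATIM) ⟸ modularity
  `exists_isNewformOf` ∧ CDT tame type `fullLevelHomology_isIsotypic_tamePrincipalSeries_of_central` ∧ SIGNED WEIGHT ∧ Kraus Prop. 1 ∧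
  Edixhoven Thm. 4.5;
* `ordinaryLowValuationOptimalManinUnitGeEleven_of_named_inputs` — **GE11** (`OrdinaryLowValuationOptimalManinUnitGeEleven`) from the same
  five and Edixhoven 1991 Thm. 3 (`edixhoven_not_dvd_maninConstant_of_kodairaSymbol_ne`).

State of the K-line after this file: NOTHING route-posited remains; K ⟸ {C13 modularity, CDT 1999 L4.2.4(2)/§5.3 (cite-only), BDJ 2010 §2 +
Ash–Stevens 1986 Thm. 3.5 signed (cite-only), Kraus 1997 Prop. 1 (cite-only), Edixhoven 1992 Thm. 4.5 (cite-only)}.  K is NOT closed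
(conditional result); BSD is not proved by this.
-/

set_option autoImplicit false
-- single-conjunct summit: `Summit.BirchSwinnertonDyer.BirchSwinnertonDyer.…` repeats the name by design
set_option linter.dupNamespace false

noncomputable section

open scoped MatrixGroups
open Function CongruenceSubgroup
open Literature.RepresentationTheory.FiniteGroups Literature.RepresentationTheory.FiniteGroups.GL2
  Literature.NumberTheory.EllipticCurves.ModularForms
open Literature.NumberTheory.EllipticCurves (Kato2004.teichmullerChar)
open Literature.NumberTheory.ModularSymbols Literature.NumberTheory.ModularSymbols.FullLevel
open Literature.NumberTheory.GaloisRepresentations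
open Literature.NumberTheory.Automorphic

namespace Summit.BirchSwinnertonDyer.BirchSwinnertonDyer.Theorems.TeichmullerTwistDescent

open WeierstrassCurve Literature.NumberTheory.EllipticCurves Literature.NumberTheory.EllipticCurves.Rank1Residual
open Summit.BirchSwinnertonDyer.BirchSwinnertonDyer.Theses.TeichmullerTwistDescent

namespace KOfNamedInputs

/-- The signed weight fact implies the sign-free one (`p − 1 ∣ s + c ⟹ p − 1 ∣ 2(s + c)`): the two Literature named facts are
consistent, the second being the first with the residue of `s` forgotten.
[cite: BuzzardDiamondJarvis2010, §2 Prop. 2.5, Cor. 2.10 (2)] [cite: AshStevens1986, Thm. 3.5 (a)] -/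
theorem fullLevelHomology_twist_isModular_of_eigenMap_of_signed
    (h : fullLevelHomology_twist_isModular_of_eigenMap_signed) : fullLevelHomology_twist_isModular_of_eigenMap := by
  intro p M _ _ E _ g c hp5 hpM hg hdiv hirr hΘ ρ hρ k _ _ _ _ _ j
  obtain ⟨s, N, hN0, f, ιf, hs, hpN, hf, hgal⟩ := h p M E g c hp5 hpM hg hdiv hirr hΘ ρ hρ k j
  exact ⟨s, N, hN0, f, ιf, Dvd.dvd.mul_left hs 2, hpN, hf, hgal⟩

/-- **(W‴) `NoEtaleWeightEigenQuotient` IN FULL from three NAMED cite-only facts**: the signed weight statement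
`fullLevelHomology_twist_isModular_of_eigenMap_signed` (Buzzard–Diamond–Jarvis 2010 §2 / Ash–Stevens 1986 Thm. 3.5, read in the tree's
Hecke conventions), Kraus 1997 Prop. 1 and Edixhoven 1992 Thm. 4.5 (`WeightExclusion.noEtaleWeightEigenQuotient_of_signed_weight` with its
inline hypothesis now named).  (W‴) is proved CONDITIONALLY on the three facts; nothing route-posited.
[cite: BuzzardDiamondJarvis2010, §2 Prop. 2.5, Cor. 2.10 (2)] [cite: Kraus1997Dissertationes, Prop. 1] [cite: Edixhoven1992, Thm. 4.5] -/
theorem noEtaleWeightEigenQuotient_of_named_facts (hWt : fullLevelHomology_twist_isModular_of_eigenMap_signed)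
    (hKr : Kraus1997.propOne_inertiaShape_of_ordinary) (hEd : edixhoven1992_serreWeight_le_weight_of_newform) :
    NoEtaleWeightEigenQuotient :=
  WeightExclusion.noEtaleWeightEigenQuotient_of_signed_weight hWt hKr hEd

/-- **K (`TwistedPeriodLatticeSaturation`, the route decl VERBATIM) from five NAMED inputs**: modularity `exists_isNewformOf` (C13), the
cite-only tame-type fact `fullLevelHomology_isIsotypic_tamePrincipalSeries_of_central` (Conrad–Diamond–Taylor 1999 L4.2.4 (2), §5.3), the
cite-only signed weight fact `fullLevelHomology_twist_isModular_of_eigenMap_signed` (Buzzard–Diamond–Jarvis 2010 §2 with Ash–Stevens 1986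
Thm. 3.5), Kraus 1997 Prop. 1 and Edixhoven 1992 Thm. 4.5 (`WeightExclusion.twistedPeriodLatticeSaturation_of_five_inputs` with its third
hypothesis now named).  BSD is not proved by this; K is proved CONDITIONALLY (five hypotheses, each a published statement cited to its
source or modularity — none of them the crux or a paraphrase of it).
[cite: ConradDiamondTaylor1999, Lemma 4.2.4 (2), §5.3] [cite: BuzzardDiamondJarvis2010, §2 Prop. 2.5, Cor. 2.10 (2)]
[cite: Kraus1997Dissertationes, Prop. 1] [cite: Edixhoven1992, Thm. 4.5] [cite: EdixhovenManin1991, §4] -/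
theorem twistedPeriodLatticeSaturation_of_named_inputs (hnf : exists_isNewformOf)
    (hT : fullLevelHomology_isIsotypic_tamePrincipalSeries_of_central)
    (hWt : fullLevelHomology_twist_isModular_of_eigenMap_signed)
    (hKr : Kraus1997.propOne_inertiaShape_of_ordinary) (hEd : edixhoven1992_serreWeight_le_weight_of_newform) :
    Summit.BirchSwinnertonDyer.BirchSwinnertonDyer.Theses.TeichmullerTwistDescent.TwistedPeriodLatticeSaturation :=
  WeightExclusion.twistedPeriodLatticeSaturation_of_five_inputs hnf hT hWt hKr hEd

/-- **GE11 (`OrdinaryLowValuationOptimalManinUnitGeEleven`) from six NAMED inputs**: the five of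
`twistedPeriodLatticeSaturation_of_named_inputs` and Edixhoven 1991 Thm. 3 outside Kodaira II/III/IV
(`edixhoven_not_dvd_maninConstant_of_kodairaSymbol_ne`), by `KOfTameType.ordinaryLowValuationOptimalManinUnitGeEleven_of_tameTypeCentral_inputs`.
Conditional on the six named hypotheses; BSD is not proved by this.
[cite: EdixhovenManin1991, Thm. 3 and §4] [cite: ConradDiamondTaylor1999, Lemma 4.2.4 (2), §5.3] [cite: BuzzardDiamondJarvis2010, §2 Prop. 2.5, Cor. 2.10 (2)]
[cite: Kraus1997Dissertationes, Prop. 1] [cite: Edixhoven1992, Thm. 4.5] -/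
theorem ordinaryLowValuationOptimalManinUnitGeEleven_of_named_inputs (hnf : exists_isNewformOf)
    (hEdix : edixhoven_not_dvd_maninConstant_of_kodairaSymbol_ne)
    (hT : fullLevelHomology_isIsotypic_tamePrincipalSeries_of_central)
    (hWt : fullLevelHomology_twist_isModular_of_eigenMap_signed)
    (hKr : Kraus1997.propOne_inertiaShape_of_ordinary) (hEd : edixhoven1992_serreWeight_le_weight_of_newform) :
    OrdinaryLowValuationOptimalManinUnitGeEleven :=
  KOfTameType.ordinaryLowValuationOptimalManinUnitGeEleven_of_tameTypeCentral_inputs hnf hEdix hT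
    (noEtaleWeightEigenQuotient_of_named_facts hWt hKr hEd)

end KOfNamedInputs

end Summit.BirchSwinnertonDyer.BirchSwinnertonDyer.Theorems.TeichmullerTwistDescent
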